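import Literature.AlgebraicGeometry.Motives.GoodReductionFormalFunctionsProofs
import HarnessLib

/-!
# Lifting idempotents from the closed fibre, from the theorem on formal functions (Tags 0G7X, 02OD)

The Stacks Project, Tag 0G7X (Derived Categories of Schemes, Lemma
`lemma-proper-idempotent-on-fibre`): "Let `f : X → S` be a proper morphism of schemes. Let
`s ∈ S` and let `e ∈ H⁰(X_s, 𝒪_{X_s})` be an idempotent. Then `e` is in the image of the map
`(f_*𝒪_X)_s → H⁰(X_s, 𝒪_{X_s})`." Printed proof, Noetherian case: "We will use the theorem on
formal functions in the form of Cohomology of Schemes, Lemma [Tag 02OD]. It tells us that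
`(f_*𝒪_X)_s^∧ = lim_n H⁰(X_n, 𝒪_{X_n})` where `X_n` is the `n`th infinitesimal neighbourhood of
`X_s`. Since the underlying topological space of `X_n` is equal to that of `X_s` we obtain for all
`n` a disjoint union decomposition of schemes `X_n = T_{1,n} ⨿ T_{2,n}` […] This means
`H⁰(X_n, 𝒪_{X_n})` contains a nontrivial idempotent `e_n` […] `e_{n+1}` restricts to `e_n` on
`X_n`. Hence `e_∞ = lim e_n` is a nontrivial idempotent of the limit. Thus `e_∞` is an element of
the completion of `(f_*𝒪_X)_s` mapping to `e` in `H⁰(X_s, 𝒪_{X_s})` […]" (the general case is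
reduced to this one by Noetherian approximation, Limits, Lemma [Tag 0A0P]).

This file PROVES that Noetherian step over a LOCAL base `S = Spec A` (where `(f_*𝒪_X)_s` at the
closed point `s` is `Γ(X, 𝒪_X)`), from the surjectivity half of the theorem on formal functions
for `H⁰` as spelled out in `Literature/AlgebraicGeometry/Morphisms/FormalFunctions.lean`
(`HasSurjectiveFormalFunctions 𝔪 f`, Tag 02OC for `p = 0`, `𝓕 = 𝒪_X`), with the compatible
idempotents `e_n` produced by Hensel's lemma for `T² − T` along the surjective closed immersions
`X_s → X_n` (`Motives.existsUnique_isRoot_of_isClosedImmersion`) instead of the topological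
argument — exactly as in the tree's `Motives.mem_range_algebraMapΓ_of_isRoot`, whose hypothesis
`Γ(X, 𝒪_X) = A` is dropped here:

* `mem_range_appTop_fst_of_isRoot` — for `A` Noetherian, `q : A → k₀` surjective with kernel `I`,
  `f : X → Spec A` proper with `HasSurjectiveFormalFunctions I f`: a simple root
  `θ ∈ Γ(X ×_A k₀, 𝒪)` of a monic `F ∈ k₀[T]` is the restriction of a global function on `X`
  (lift `F` to a monic `G ∈ A[T]`, lift `θ` uniquely to roots `y_n` of `G` on the `X_n`,
  compatible by uniqueness, and apply formal functions to `(y_n)`).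
* `mem_range_appTop_fst_of_isIdempotentElem_of_hasSurjectiveFormalFunctions` — **Tag 0G7X for a
  proper scheme over a Noetherian local ring, from Tag 02OC**: for `(A, 𝔪)` Noetherian local,
  `g : Y → Spec A` proper with `HasSurjectiveFormalFunctions 𝔪 g`, every idempotent of
  `Γ(Y ×_A Spec κ(𝔪), 𝒪)` is the restriction of a global function on `Y` (`e` is a simple root of
  `T² − T`: `(2e − 1)² = 1`).

This is the form of Tag 0G7X consumed, as hypothesis `H` over ALL local rings, by the reduction
`Literature.AlgebraicGeometry.Morphisms.steinFactorization_geometricallyConnected_of_idempotentLifting`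
(`Literature/AlgebraicGeometry/Morphisms/SteinFactorizationReduction.lean`) of Zariski's
connectedness theorem (Tag 03H2 (1)); what this file does NOT provide is
`HasSurjectiveFormalFunctions 𝔪 g` itself for a general proper `g` (the coherence theorem,
Tag 02O5, beyond the flat principal-ideal case of `FormalFunctionsCechProofs.lean`) and the
non-Noetherian case of Tag 0G7X (Noetherian approximation of proper morphisms, Tag 0A0P).

## References

* The Stacks Project, Tag 0G7X (Derived Categories of Schemes, Lemma
  lemma-proper-idempotent-on-fibre, Noetherian case of the proof); Tag 02OD, 02OC (Cohomology
  of Schemes, Lemma 30.20.6 and Theorem 30.20.5); Tag 03H0 (More on Morphisms, Theorem 37.53.4,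
  proof). [StacksProject]
-/

noncomputable section

open CategoryTheory CategoryTheory.Limits AlgebraicGeometry TopologicalSpace Opposite Polynomial

universe u

namespace Literature.AlgebraicGeometry.Morphisms

open infinitesimalNeighbourhood

/-- **Simple roots on the closed fibre lift to global functions** (the lifting step of the
Noetherian case of The Stacks Project, Tag 0G7X, with Hensel's lemma in place of the topological
lifting; the tree's `Motives.mem_range_algebraMapΓ_of_isRoot` without its hypothesis
`Γ(X, 𝒪_X) = A`). Let `A` be Noetherian, `q : A → k₀` surjective with kernel `I`,
`f : X → Spec A` proper with `HasSurjectiveFormalFunctions I f` (Tag 02OC, `p = 0`), and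
`X₀ = X ×_A k₀`. If `θ ∈ Γ(X₀, 𝒪)` is a simple root of a monic `F ∈ k₀[T]` (`F(θ) = 0`, `F'(θ)`
a unit), then `θ` is the restriction of a global function on `X`: lift `F` to a monic
`G ∈ A[T]`; `θ` lifts uniquely to a root `y_n` of `G` on each infinitesimal neighbourhood `X_n`
(`Motives.existsUnique_isRoot_of_isClosedImmersion`: `X₀ → X_n` is a surjective closed
immersion), compatibly in `n` by uniqueness; by formal functions `(y_n)_n = (m_n|_{X_n})_n` for a
sequence `m_n ∈ Γ(X, 𝒪_X)`, and `m_0` restricts to `y_0|_{X₀} = θ`.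
[cite: StacksProject, Tag 0G7X (Derived Categories of Schemes, Lemma lemma-proper-idempotent-on-fibre, Noetherian case) and Tag 02OC] -/
theorem mem_range_appTop_fst_of_isRoot {A : Type u} [CommRing A] [IsNoetherianRing A]
    {X : Scheme.{u}} (f : X ⟶ Spec (.of A)) [IsProper f] {k₀ : Type u} [CommRing k₀]
    (q : A →+* k₀) (hFF : HasSurjectiveFormalFunctions (RingHom.ker q) f)
    (hq : Function.Surjective q) (F : k₀[X]) (hF : F.Monic)
    (θ : Γ(pullback f (Spec.map (CommRingCat.ofHom q)), ⊤))
    (hθ : (F.map (algebraMapΓ (pullback.snd f (Spec.map (CommRingCat.ofHom q))))).IsRoot θ)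
    (hθ' : IsUnit ((F.map (algebraMapΓ
      (pullback.snd f (Spec.map (CommRingCat.ofHom q))))).derivative.eval θ)) :
    θ ∈ Set.range (pullback.fst f (Spec.map (CommRingCat.ofHom q))).appTop := by
  set I : Ideal A := RingHom.ker q with hIdef
  have hI : I ≤ RingHom.ker q := le_rfl
  set g := pullback.snd f (Spec.map (CommRingCat.ofHom q)) with hg
  set σ : (n : ℕ) →
      (pullback f (Spec.map (CommRingCat.ofHom q)) ⟶ infinitesimalNeighbourhood I f n) :=
    fun n ↦ toInfinitesimalNeighbourhood I f q hI n with hσ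
  haveI : Fact (Function.Surjective q) := ⟨hq⟩
  haveI hσs : ∀ n, Surjective (σ n) := fun n ↦
    surjective_toInfinitesimalNeighbourhood I f q hI hq le_rfl n
  -- lift `F` to a monic `G ∈ A[T]`
  obtain ⟨G, hGF, -, hG⟩ := Polynomial.lifts_and_natDegree_eq_and_monic
    ((Polynomial.mem_lifts _).mpr (Polynomial.map_surjective q hq F)) hF
  -- the polynomial `G` on `X_n`, and its pull-back to `X₀`
  set φ : (n : ℕ) → (A →+* Γ(infinitesimalNeighbourhood I f n, ⊤)) :=
    fun n ↦ (restrict I f n).comp (algebraMapΓ f) with hφ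
  have hφσ : ∀ n, (σ n).appTop.hom.comp (φ n) = (algebraMapΓ g).comp q := by
    intro n
    ext a
    change (σ n).appTop.hom ((ι I f n).appTop.hom (algebraMapΓ f a)) = algebraMapΓ g (q a)
    rw [← appTop_fst_algebraMapΓ, ← toInfinitesimalNeighbourhood_ι I f q hI n,
      Scheme.Hom.comp_appTop]
    rfl
  have hGσ : ∀ n, ((G.map (φ n)).map (σ n).appTop.hom) = F.map (algebraMapΓ g) := by
    intro n
    rw [Polynomial.map_map, hφσ, ← Polynomial.map_map, hGF]
  -- instances on `X_n`
  haveI : ∀ n, IsNoetherianRing (CommRingCat.of (A ⧸ I ^ (n + 1))) := fun n ↦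
    inferInstanceAs (IsNoetherianRing (A ⧸ I ^ (n + 1)))
  haveI : ∀ n, CompactSpace ↥(infinitesimalNeighbourhood I f n) := fun n ↦ inferInstance
  haveI : ∀ n, IsLocallyNoetherian (infinitesimalNeighbourhood I f n) := fun n ↦ inferInstance
  -- unique lifts `y n` of `θ` to roots of `G` on `X_n`
  have hex : ∀ n, ∃! y : Γ(infinitesimalNeighbourhood I f n, ⊤),
      (G.map (φ n)).IsRoot y ∧ (σ n).appTop y = θ := fun n ↦
    Literature.AlgebraicGeometry.Motives.existsUnique_isRoot_of_isClosedImmersion (σ := σ n)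
      (hG.map _) (by rwa [hGσ]) (by rwa [hGσ])
  choose y hy hyu using hex
  -- compatibility under the transition maps
  have hcompat : ∀ n, (transition I f n).appTop.hom (y (n + 1)) = y n := by
    intro n
    refine hyu n _ ⟨?_, ?_⟩
    · have e : (G.map (φ (n + 1))).map (transition I f n).appTop.hom = G.map (φ n) := by
        rw [Polynomial.map_map]
        congr 1
        ext a
        exact transition_appTop_restrict I f n (algebraMapΓ f a)
      rw [IsRoot.def, ← e, eval_map, eval₂_hom, (hy (n + 1)).1.eq_zero, map_zero]
    · change ((transition I f n).appTop ≫ (σ n).appTop) (y (n + 1)) = θ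
      rw [← Scheme.Hom.comp_appTop, hσ, toInfinitesimalNeighbourhood_transition]
      exact (hy (n + 1)).2
  -- formal functions: `(y n)` comes from a Cauchy sequence of global functions
  obtain ⟨m, -, hm⟩ := hFF y hcompat
  refine ⟨m 0, ?_⟩
  rw [← (hy 0).2, ← hm 0]
  change _ = ((ι I f 0).appTop ≫ (σ 0).appTop) (m 0)
  rw [← Scheme.Hom.comp_appTop, hσ, toInfinitesimalNeighbourhood_ι]

/-- **Tag 0G7X over a Noetherian local base, from the theorem on formal functions** (The Stacks
Project, Tag 0G7X, Noetherian case of the proof: "`e_∞ = lim e_n` […] is an element of the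
completion of `(f_*𝒪_X)_s` mapping to `e`"). For `(A, 𝔪)` Noetherian local and
`g : Y → Spec A` proper such that `Γ(Y, 𝒪_Y)^∧ → lim_n Γ(Y_n, 𝒪_{Y_n})` is surjective for the
`𝔪`-adic infinitesimal neighbourhoods (`HasSurjectiveFormalFunctions 𝔪 g`, Tag 02OC for `p = 0`,
`𝓕 = 𝒪`), every idempotent `e` of `Γ(Y ×_A Spec κ(𝔪), 𝒪)` is the restriction of a global function
on `Y` — `e` is a simple root of `T² − T` (`(2e−1)² = 1`), so `mem_range_appTop_fst_of_isRoot`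
applies. Over the local base `Spec A` the stalk `(g_*𝒪_Y)_s` at the closed point is
`Γ(Y, 𝒪_Y)`, so this is literally the statement of Tag 0G7X there; it is the hypothesis `H` of
`steinFactorization_geometricallyConnected_of_idempotentLifting`, for Noetherian `A`.
[cite: StacksProject, Tag 0G7X (Derived Categories of Schemes, Lemma lemma-proper-idempotent-on-fibre, Noetherian case)] -/
theorem mem_range_appTop_fst_of_isIdempotentElem_of_hasSurjectiveFormalFunctions
    {A : Type u} [CommRing A] [IsLocalRing A] [IsNoetherianRing A]
    {Y : Scheme.{u}} (g : Y ⟶ Spec (.of A)) [IsProper g]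
    (hFF : HasSurjectiveFormalFunctions (IsLocalRing.maximalIdeal A) g)
    (e : Γ(pullback g (Spec.map (CommRingCat.ofHom (IsLocalRing.residue A))), ⊤))
    (he : IsIdempotentElem e) :
    e ∈ Set.range (pullback.fst g (Spec.map (CommRingCat.ofHom (IsLocalRing.residue A)))).appTop := by
  have hker : RingHom.ker (IsLocalRing.residue A) = IsLocalRing.maximalIdeal A :=
    IsLocalRing.ker_residue
  have hF : (X ^ 2 - X : (IsLocalRing.ResidueField A)[X]).Monic :=
    (Polynomial.monic_X_pow 2).sub_of_left (by
      rw [Polynomial.degree_X_pow, Polynomial.degree_X]; exact Nat.one_lt_ofNat)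
  refine mem_range_appTop_fst_of_isRoot g (IsLocalRing.residue A) (by rwa [hker])
    IsLocalRing.residue_surjective _ hF e ?_ ?_
  · rw [IsRoot.def, Polynomial.map_sub, Polynomial.map_pow, Polynomial.map_X, eval_sub, eval_pow,
      eval_X, sq, he.eq, sub_self]
  · have h2 : ((X ^ 2 - X : (IsLocalRing.ResidueField A)[X]).map (algebraMapΓ (pullback.snd g
        (Spec.map (CommRingCat.ofHom (IsLocalRing.residue A)))))).derivative.eval e = 2 * e - 1 := by
      rw [Polynomial.map_sub, Polynomial.map_pow, Polynomial.map_X, derivative_sub,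
        derivative_X_pow, derivative_X]
      simp [eval_sub, eval_mul, eval_X]
    rw [h2]
    refine ⟨⟨2 * e - 1, 2 * e - 1, ?_, ?_⟩, rfl⟩ <;>
    · calc (2 * e - 1) * (2 * e - 1) = 4 * (e * e) - 4 * e + 1 := by ring
        _ = 1 := by rw [he.eq]; ring

end Literature.AlgebraicGeometry.Morphisms

end
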